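import Summits.HubbardSuperconductivity.HubbardSuperconductivity.Theorems.NodalWardXYDefs
import Literature.Probability.LatticeModels.GarbanSpencerXYLongRangeOrderProofs
import Literature.Probability.LatticeModels.GinibreInequality
import Literature.Probability.LatticeModels.SphereCircleBridge
import Literature.Probability.LatticeModels.ThermodynamicLimit
import Literature.Probability.LatticeModels.XYTorusFreeBoxComparison
import Literature.Probability.LatticeModels.RotatorAngleCubeGinibre

/-!
# `PerturbedXYOrder` (stmt-HubbardSuperconductivity-10739) — line `schwarz-inheritance`, stub `stub_realPlateauOdd`

K = 0 plateau of the 3D plane rotator on large odd tori, uniformly in L (RP-free: Garban–Spencer on a free sub-box + Ginibre).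

Proof.  At `K = 0` the complex plateau is real:
`Re cratio_L(J,0) = L⁻⁶ Σ_{x,y ∈ (ℤ/Lℤ)³} ⟨cos(θ_x − θ_y)⟩_{J,L}` with the torus rotator expectation
`⟨F⟩_{J,L} = ∫_{[0,2π]^Λ} F e^{J Σ_{(x,i)} cos(θ_{x+eᵢ} − θ_x)} dθ / ∫ e^{J Σ cos}` (`odd_re_cratio_zero`), and each
such expectation is a Ginibre expectation on the compact abelian group `U(1)^{(ℤ/Lℤ)³}` for the directed-bond
characters `θ ↦ θ̄_x θ_{x+eᵢ}` (`odd_twoPoint_div_eq_ginibreExpect`, tree: `rotator_twoPoint_div_eq_ginibreExpect`).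
All of them are `≥ 0` (Griffiths I, tree: `torus_ginibreExpect_reChar_nonneg`).  With `n = (L−1)/2` the centred cube
`Λ_n = {-n,…,n}³ ⊂ ℤ³` projects injectively into the torus, so by Ginibre's comparison (tree:
`latticeBonds_expect_cosDiff_le_torus`) the torus two-point function of `(π z, π z')` dominates the free-boundary
two-point function `⟨cos(θ_z − θ_{z'})⟩^{free}_{Λ_n,J}` of the XY model on `Λ_n`, which is the `O(2)` two-point function of
`ONModel` (tree: `onTwoPoint_onMeasure_two_eq_expect`) and hence `≥ 1 − √(a log J / J) ≥ 1/2` for `J ≥ max(β_c, 1, 64a²)`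
by Garban–Spencer (tree: `GarbanSpencer2022_xyLongRangeOrder_holds`) whenever the ball `B((z+z')/2, 2‖z−z'‖)` lies in
`Λ_n` — which holds for all `z, z'` in the central cube `{-k,…,k}³`, `k = n/8` (`odd_ball_subset_box`).  These
`(2k+1)⁶ ≥ (L/16)⁶` pairs (for `L ≥ 16`) give `Re cratio_L(J,0) ≥ 2⁻¹·16⁻⁶`.  The parity of `L` is not used.
-/

/- STATUS (worker `odd`, 2026-08-16 05:55Z): PROOF COMPLETE, sorry-free, 235 lines, axioms = propext/Classical.choice/Quot.sound
   (verified on the inlined dev copy work/stubs/scratch-odd/DevStub.lean, rc 0).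
   Helper Literature files LANDED: p78945 ACCEPTED Literature/Probability/LatticeModels/XYTorusFreeBoxComparison.lean,
   p78950 ACCEPTED Literature/Probability/LatticeModels/RotatorAngleCubeGinibre.lean (both imported below).
   BLOCKER at 05:55Z: the Lean farm had not yet BUILT the olean of RotatorAngleCubeGinibre (`lean check` → rc 75
   "remote:stale:unbuilt"), so this file could not be re-checked/landed yet.  TODO when `./chk.sh work/stubs/RealPlateauOdd.lean`
   gives rc 0: `ledger propose --target Summits/HubbardSuperconductivity/HubbardSuperconductivity/Theorems/NodalWardXYPerturbedXYOrderRealPlateauOdd.lean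
   --file work/stubs/RealPlateauOdd.lean --supports stmt-HubbardSuperconductivity-10739 --note "stub stub_realPlateauOdd for line schwarz-inheritance"`
   (real proposals return in seconds; --dry-run blocks > 30 min under load — skip it), then `ledger wait p<ID> --timeout 300`.
   Fallback (compiles without the new modules' oleans? no — same imports inlined): work/stubs/scratch-odd/DevStub.lean (681 lines). -/

noncomputable section

namespace Summit.HubbardSuperconductivity.HubbardSuperconductivity.Theorems.PerturbedXYOrder

open MeasureTheory Literature.Probability.LatticeModels
open Summit.HubbardSuperconductivity.HubbardSuperconductivity.Theses.NodalWardXY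

variable {L : ℕ}

/-- `W_0 = 0`: at `K = 0` the perturbation vanishes. -/
theorem odd_Wk_zero [NeZero L] (θ : TorusSite 3 L → ℝ) : Wk (0 : Bond L → Bond L → ℂ) θ = 0 := by
  simp [Wk]

/-- At `K = 0` the complex integrand is the real rotator weight `e^{J Σ_b cos ∇_b θ}`. -/
theorem odd_wJ_mul_exp_Wk_zero [NeZero L] (J : ℝ) (θ : TorusSite 3 L → ℝ) :
    wJ J θ * Complex.exp (Wk (0 : Bond L → Bond L → ℂ) θ) =
      ((Real.exp (J * ∑ b : Bond L, Real.cos (θ (b.1 + Pi.single b.2 1) - θ b.1)) : ℝ) : ℂ) := by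
  rw [odd_Wk_zero, Complex.exp_zero, mul_one]; rfl

/-- **The real plateau at `K = 0` as an average of rotator two-point functions**:
`Re cratio_L(J, 0) = L⁻⁶ Σ_{x,y} ∫ cos(θ_x − θ_y) w_J / ∫ w_J` on the angle cube `[0,2π]^Λ`. -/
theorem odd_re_cratio_zero (L : ℕ) [NeZero L] (J : ℝ) :
    (cratio L J (0 : Bond L → Bond L → ℂ)).re =
      (∑ x : TorusSite 3 L, ∑ y : TorusSite 3 L,
        (∫ θ in cube L, Real.cos (θ x - θ y) *
            Real.exp (J * ∑ b : Bond L, Real.cos (θ (b.1 + Pi.single b.2 1) - θ b.1))) /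
          ∫ θ in cube L, Real.exp (J * ∑ b : Bond L, Real.cos (θ (b.1 + Pi.single b.2 1) - θ b.1))) /
        (L : ℝ) ^ 6 := by
  have hZ : Zk J (0 : Bond L → Bond L → ℂ) =
      ((∫ θ in cube L, Real.exp (J * ∑ b : Bond L, Real.cos (θ (b.1 + Pi.single b.2 1) - θ b.1)) : ℝ) : ℂ) := by
    unfold Zk
    simp_rw [odd_wJ_mul_exp_Wk_zero]
    exact integral_complex_ofReal
  have hN : num J (0 : Bond L → Bond L → ℂ) =
      ((∑ x : TorusSite 3 L, ∑ y : TorusSite 3 L, ∫ θ in cube L, Real.cos (θ x - θ y) *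
        Real.exp (J * ∑ b : Bond L, Real.cos (θ (b.1 + Pi.single b.2 1) - θ b.1)) : ℝ) : ℂ) := by
    unfold num
    simp_rw [odd_wJ_mul_exp_Wk_zero, ← Complex.ofReal_mul, integral_complex_ofReal, Complex.ofReal_sum]
  unfold cratio
  rw [hZ, hN]
  have hL : ((L : ℂ)) ^ 6 = (((L : ℝ) ^ 6 : ℝ) : ℂ) := by push_cast; ring
  rw [hL, ← Complex.ofReal_div, ← Complex.ofReal_div, Complex.ofReal_re, Finset.sum_div]
  congr 1
  refine Finset.sum_congr rfl fun x _ => ?_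
  rw [Finset.sum_div]

/-- **Each rotator two-point ratio on the torus is a Ginibre expectation on `U(1)^Λ`** for the
directed-bond characters `θ ↦ θ̄_x θ_{x+eᵢ}` with constant couplings `J`
(change of variables `θ ↦ e^{iθ}`, tree: `rotator_twoPoint_div_eq_ginibreExpect`). -/
theorem odd_twoPoint_div_eq_ginibreExpect (L : ℕ) [NeZero L] (J : ℝ) (x y : TorusSite 3 L) :
    (∫ θ in cube L, Real.cos (θ x - θ y) *
          Real.exp (J * ∑ b : Bond L, Real.cos (θ (b.1 + Pi.single b.2 1) - θ b.1))) /
        ∫ θ in cube L, Real.exp (J * ∑ b : Bond L, Real.cos (θ (b.1 + Pi.single b.2 1) - θ b.1)) =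
      ginibreExpect (torusHaar (TorusSite 3 L))
        (fun b : TorusSite 3 L × Fin 3 => diffChar b.1 (b.1 + Pi.single b.2 1)) (fun _ => J)
        (reChar (diffChar y x)) := by
  unfold cube
  exact rotator_twoPoint_div_eq_ginibreExpect (V := TorusSite 3 L)
    (fun b : TorusSite 3 L × Fin 3 => b.1) (fun b : TorusSite 3 L × Fin 3 => b.1 + Pi.single b.2 1) J x y

/-- The Garban–Spencer rate is at most `1/2` beyond an explicit threshold: for `a > 0` and
`J ≥ max 1 (64 a²)`, `1/2 ≤ 1 − √(a log J / J)` (`log J ≤ 2√J`). -/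
theorem odd_half_le_one_sub_sqrt {a J : ℝ} (ha : 0 < a) (hJ1 : 1 ≤ J) (hJa : 64 * a ^ 2 ≤ J) :
    1 / 2 ≤ 1 - Real.sqrt (a * Real.log J / J) := by
  have hJ0 : 0 < J := by linarith
  have hsq : 0 < Real.sqrt J := Real.sqrt_pos.2 hJ0
  have hlog : Real.log J ≤ 2 * Real.sqrt J := by
    have h1 := Real.log_le_sub_one_of_pos hsq
    rw [Real.log_sqrt hJ0.le] at h1
    linarith
  have h8 : 8 * a ≤ Real.sqrt J := by
    rw [Real.le_sqrt (by positivity) hJ0.le]; nlinarith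
  have hbound : a * Real.log J / J ≤ (1 / 2) ^ 2 := by
    rw [div_le_iff₀ hJ0]
    nlinarith [mul_le_mul_of_nonneg_left hlog ha.le, mul_le_mul_of_nonneg_right h8 hsq.le,
      Real.mul_self_sqrt hJ0.le]
  have hs : Real.sqrt (a * Real.log J / J) ≤ 1 / 2 := by
    rw [Real.sqrt_le_left (by norm_num)]
    exact hbound
  linarith

/-- **The ball condition of Garban–Spencer for pairs in the central cube.** If `8k ≤ n` and
`z, z' ∈ {-k,…,k}³`, every lattice point `w` with `‖w − (z'+z)/2‖₂ ≤ 2‖z' − z‖₂` lies in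
`{-n,…,n}³`. -/
theorem odd_ball_subset_box {n k : ℕ} (h8k : 8 * k ≤ n) {z z' : Site 3} (hz : z ∈ box 3 k)
    (hz' : z' ∈ box 3 k) (w : Site 3)
    (hw : ∑ i, ((w i : ℝ) - ((z' i : ℝ) + (z i : ℝ)) / 2) ^ 2 ≤ 4 * ∑ i, ((z' i : ℝ) - (z i : ℝ)) ^ 2) :
    w ∈ box 3 n := by
  rw [mem_box] at hz hz' ⊢
  have hk0 : (0 : ℝ) ≤ k := Nat.cast_nonneg k
  have hkn : (8 * k : ℝ) ≤ n := by exact_mod_cast h8k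
  have hzr : ∀ i, -(k : ℝ) ≤ z i ∧ (z i : ℝ) ≤ k := fun i => by
    obtain ⟨h1, h2⟩ := hz i; exact ⟨by exact_mod_cast h1, by exact_mod_cast h2⟩
  have hzr' : ∀ i, -(k : ℝ) ≤ z' i ∧ (z' i : ℝ) ≤ k := fun i => by
    obtain ⟨h1, h2⟩ := hz' i; exact ⟨by exact_mod_cast h1, by exact_mod_cast h2⟩
  have hdiff : ∀ i, ((z' i : ℝ) - (z i : ℝ)) ^ 2 ≤ (2 * k) ^ 2 := fun i => by
    obtain ⟨h1, h2⟩ := hzr i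
    obtain ⟨h1', h2'⟩ := hzr' i
    exact sq_le_sq' (by linarith) (by linarith)
  have hsum : ∑ i, ((z' i : ℝ) - (z i : ℝ)) ^ 2 ≤ 3 * (2 * k) ^ 2 := by
    calc ∑ i, ((z' i : ℝ) - (z i : ℝ)) ^ 2 ≤ ∑ _i : Fin 3, (2 * (k : ℝ)) ^ 2 :=
          Finset.sum_le_sum fun i _ => hdiff i
      _ = 3 * (2 * k) ^ 2 := by simp
  intro j
  have hj : ((w j : ℝ) - ((z' j : ℝ) + (z j : ℝ)) / 2) ^ 2 ≤ (7 * k) ^ 2 := by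
    calc ((w j : ℝ) - ((z' j : ℝ) + (z j : ℝ)) / 2) ^ 2
        ≤ ∑ i, ((w i : ℝ) - ((z' i : ℝ) + (z i : ℝ)) / 2) ^ 2 :=
          Finset.single_le_sum (f := fun i => ((w i : ℝ) - ((z' i : ℝ) + (z i : ℝ)) / 2) ^ 2)
            (fun i _ => sq_nonneg _) (Finset.mem_univ j)
      _ ≤ 4 * (3 * (2 * k) ^ 2) := hw.trans (by linarith)
      _ ≤ (7 * k) ^ 2 := by nlinarith
  obtain ⟨hlo, hhi⟩ := abs_le_of_sq_le_sq' hj (by positivity)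
  obtain ⟨h1, h2⟩ := hzr j
  obtain ⟨h1', h2'⟩ := hzr' j
  constructor
  · have : -(n : ℝ) ≤ w j := by linarith
    exact_mod_cast this
  · have : (w j : ℝ) ≤ n := by linarith
    exact_mod_cast this

/-- **The `K = 0` plateau on large odd tori** (reflection positivity is silent there): Garban–Spencer 2022 long-range
order on a free sub-box of the torus (tree: `GarbanSpencer2022_xyLongRangeOrder_holds`; the pairs `x, y` whose ball
`B((x+y)/2, 2‖x−y‖)` stays inside the box are a positive fraction of all pairs), Ginibre's inequality to pass from the free box
to the torus (tree: `ginibreExpect_reChar_mono`; template `GinibreU1TorusGeFreeBoxD4_holds`) and `⟨cos(θ_x − θ_y)⟩ ≥ 0` for the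
remaining pairs. [cite: GarbanSpencer2022, Thm 1.3 with Remark 1] -/
theorem stub_realPlateauOdd :
    ∃ J₁ a₀ : ℝ, ∃ L₁ : ℕ, 0 < a₀ ∧ ∀ J : ℝ, J₁ ≤ J → ∀ (L : ℕ) [NeZero L], Odd L → L₁ ≤ L →
      a₀ ≤ (cratio L J 0).re := by
  obtain ⟨βc, a, _hβc, ha, hGS⟩ := GarbanSpencer2022_xyLongRangeOrder_holds 3 le_rfl
  refine ⟨max βc (max 1 (64 * a ^ 2)), 2⁻¹ * (16⁻¹) ^ 6, 16, by positivity, ?_⟩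
  intro J hJ L _ _ hL
  -- thresholds in `J`
  have hJβ : βc ≤ J := le_trans (le_max_left _ _) hJ
  have hJ1 : 1 ≤ J := le_trans (le_trans (le_max_left _ _) (le_max_right _ _)) hJ
  have hJa : 64 * a ^ 2 ≤ J := le_trans (le_trans (le_max_right _ _) (le_max_right _ _)) hJ
  have hJ0 : 0 ≤ J := by linarith
  have hhalf : 1 / 2 ≤ 1 - Real.sqrt (a * Real.log J / J) := odd_half_le_one_sub_sqrt ha hJ1 hJa
  -- geometry: the free box `{-n,…,n}³` inside the torus and the central cube `{-k,…,k}³`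
  set n : ℕ := (L - 1) / 2 with hn
  set k : ℕ := n / 8 with hk
  have h2n : 2 * n < L := by omega
  have h8k : 8 * k ≤ n := by omega
  have hkL : (L : ℝ) / 16 ≤ 2 * k + 1 := by
    have h : L ≤ 16 * (2 * k + 1) := by omega
    have h' : (L : ℝ) ≤ 16 * (2 * k + 1) := by exact_mod_cast h
    linarith
  have hinj : Set.InjOn (Torus.proj (d := 3) L) (box 3 n : Set (Site 3)) := torusProj_injOn_box_of_lt h2n
  have hsub : box 3 k ⊆ box 3 n := box_mono 3 (by omega)
  -- notation: the torus two-point Ginibre expectations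
  set GE : TorusSite 3 L → TorusSite 3 L → ℝ := fun x y =>
    ginibreExpect (torusHaar (TorusSite 3 L))
      (fun b : TorusSite 3 L × Fin 3 => diffChar b.1 (b.1 + Pi.single b.2 1)) (fun _ => J)
      (reChar (diffChar y x)) with hGE
  -- Griffiths I: every torus two-point expectation is non-negative
  have hnn : ∀ x y, 0 ≤ GE x y := fun x y =>
    torus_ginibreExpect_reChar_nonneg _ surjective_mul_self_torus _ _ fun _ => hJ0
  -- Garban–Spencer + Ginibre: pairs from the central cube have two-point function ≥ 1/2
  have hpair : ∀ p ∈ box 3 k ×ˢ box 3 k, 1 / 2 ≤ GE (Torus.proj L p.1) (Torus.proj L p.2) := by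
    intro p hp
    obtain ⟨hz, hz'⟩ := Finset.mem_product.1 hp
    have hzn : p.1 ∈ box 3 n := hsub hz
    have hz'n : p.2 ∈ box 3 n := hsub hz'
    have hgs := hGS J hJβ (box 3 n) p.2 p.1 hz'n hzn
      (fun w hw => odd_ball_subset_box h8k hz hz' w hw)
    rw [onTwoPoint_onMeasure_two_eq_expect (box 3 n) J hz'n hzn] at hgs
    have hcmp := latticeBonds_expect_cosDiff_le_torus (L := L) (box 3 n) hinj hJ0 hz'n hzn
    rw [hGE]
    dsimp only
    linarith
  -- rewrite the plateau as an average of Ginibre expectations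
  rw [odd_re_cratio_zero]
  simp_rw [odd_twoPoint_div_eq_ginibreExpect]
  change 2⁻¹ * 16⁻¹ ^ 6 ≤ (∑ x : TorusSite 3 L, ∑ y : TorusSite 3 L, GE x y) / (L : ℝ) ^ 6
  -- restrict the double sum to the (injective) image of the central pairs
  have hL0 : (0 : ℝ) < L := by exact_mod_cast NeZero.pos L
  have hinj2 : Set.InjOn (fun p : Site 3 × Site 3 => (Torus.proj L p.1, Torus.proj L p.2))
      ((box 3 k ×ˢ box 3 k : Finset (Site 3 × Site 3)) : Set (Site 3 × Site 3)) := by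
    intro p hp q hq h
    obtain ⟨hp1, hp2⟩ := Finset.mem_product.1 (Finset.mem_coe.1 hp)
    obtain ⟨hq1, hq2⟩ := Finset.mem_product.1 (Finset.mem_coe.1 hq)
    obtain ⟨h1, h2⟩ := Prod.mk.inj h
    exact Prod.ext (hinj (hsub hp1) (hsub hq1) h1) (hinj (hsub hp2) (hsub hq2) h2)
  have hsum : ((2 * k + 1 : ℕ) : ℝ) ^ 6 * (1 / 2) ≤ ∑ x : TorusSite 3 L, ∑ y : TorusSite 3 L, GE x y := by
    calc ((2 * k + 1 : ℕ) : ℝ) ^ 6 * (1 / 2)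
        = ((box 3 k ×ˢ box 3 k).card : ℝ) * (1 / 2) := by
          rw [Finset.card_product, card_box]; push_cast; ring
      _ = (box 3 k ×ˢ box 3 k).card • (1 / 2 : ℝ) := by rw [nsmul_eq_mul]
      _ ≤ ∑ p ∈ box 3 k ×ˢ box 3 k, GE (Torus.proj L p.1) (Torus.proj L p.2) :=
          Finset.card_nsmul_le_sum _ _ _ hpair
      _ = ∑ q ∈ (box 3 k ×ˢ box 3 k).image (fun p : Site 3 × Site 3 => (Torus.proj L p.1, Torus.proj L p.2)),
            GE q.1 q.2 :=
          (Finset.sum_image (f := fun q : TorusSite 3 L × TorusSite 3 L => GE q.1 q.2) hinj2).symm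
      _ ≤ ∑ q : TorusSite 3 L × TorusSite 3 L, GE q.1 q.2 :=
          Finset.sum_le_sum_of_subset_of_nonneg (Finset.subset_univ _) fun q _ _ => hnn q.1 q.2
      _ = ∑ x : TorusSite 3 L, ∑ y : TorusSite 3 L, GE x y := Fintype.sum_prod_type _
  -- conclude
  rw [le_div_iff₀ (by positivity)]
  have hk6 : ((L : ℝ) / 16) ^ 6 ≤ ((2 * k + 1 : ℕ) : ℝ) ^ 6 := by
    push_cast
    exact pow_le_pow_left₀ (by positivity) hkL 6
  calc 2⁻¹ * 16⁻¹ ^ 6 * (L : ℝ) ^ 6 = ((L : ℝ) / 16) ^ 6 * (1 / 2) := by ring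
    _ ≤ ((2 * k + 1 : ℕ) : ℝ) ^ 6 * (1 / 2) := by gcongr
    _ ≤ ∑ x : TorusSite 3 L, ∑ y : TorusSite 3 L, GE x y := hsum

end Summit.HubbardSuperconductivity.HubbardSuperconductivity.Theorems.PerturbedXYOrder

end
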